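import Literature.AnabelianGeometry.EtaleTheta.ThetaSubquotientOfTemperedQuotient
import Literature.AnabelianGeometry.EtaleTheta.ThetaCyclotomes

/-!
# [EtTh] §5: the theta subquotients `(l·Δ_Θ)_D` of the §5 data, PINNED to the §1 setting

Mochizuki, *The étale theta function and its Frobenioid-theoretic manifestations*, Publ. RIMS **45** (2009),
§5 p. 327 (PDF p. 101) [cite: MochizukiEtTh2009, §5 p.327 (PDF p.101)]: "Let us write `Π^tp_X ↠ (Π^tp_X)^Θ` for
the quotient discussed at the beginning of §1. Then `(Π^tp_X)^Θ ⊇ l·Δ_Θ` … for `D ∈ Ob(D)`, these subquotients determine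
subquotients `Aut_D(D) ↠ Aut^Θ_D(D)`; `(l·Δ_Θ)_D ⊆ Aut^Θ_D(D)`"; §5 p. 322 (PDF p. 96): "'`A`' is one of the smooth log
orbicurves `X, C, X̲, C̲, Ẋ, Ċ, Ẋ̲, Ċ̲` … the single underline case … the double underline case"; §1 p. 12 (PDF p. 237),
the quotient `Π^tp_X ↠ (Π^tp_X)^Θ` and `Δ_Θ ⊆ (Π^tp_X)^Θ`.  abc-iut cell, layer L2, seat abc-iut-L2-t9 (gen 3; unit W2-L2-05
lineage), ROW «Q PIN AT THE §1/§2 SETTING» = plan/L2 MERGE-PLAN §2 "`toThetaSubquotientStub := t9 R2 instance`" made concrete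
for abc-iut-L2-t4's junction `ThetaFrobenioid.ofThetaSettingData` (its residual input `Q`).  MODEL/CONSTRUCTION file (DEFS-FREEZE
class (b)): new file, nothing landed is edited or restated; one `Prop`-valued Mathlib-class instance (`IsMulCommutative`, the
device of `EtaleThetaClass.deltaTheta_comm`), no notation, no `Prop`-valued definition.

WHAT IS CONSTRUCTED / PROVED.  For abc-iut-L2-t1's `D : ThetaSetting p` (`Π^tp_X = D.PiTemp`,
`Π^tp_X ↠ (Π^tp_X)^Θ = D.toTheta`, abc-iut-L2-t2's `l·Δ_Θ = D.lDeltaTheta l ⊆ (Π^tp_X)^Θ`, normal — `lDeltaTheta_normal`)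
and a subgroup `U ⊆ Π^tp_X` (the tempered fundamental group "`Π`" of the base `D = B^temp(Π)⁰` of §5: `U = Π^tp_X` in the
single underline case "`A = X`", `U = Π^tp_X̲̲ = C.Huu` (abc-iut-L2-t8's `DoubleUnderline`) in the double underline case):
* `ThetaSetting.lDeltaTheta_isMulCommutative` — `l·Δ_Θ` is commutative (field `ker_thetaToEll_comm`, "`Δ_Θ (≅ Ẑ(1))`");
* **`ThetaSubquotient.ofSettingSub D l U : FrobenioidTheta.ThetaSubquotientStub (ConnectedPart (BTemp ↥U))`** — abc-iut-L2-t4's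
  §5 datum field `toThetaSubquotientStub` over `D := B^temp(U)⁰`, := abc-iut-L2-t9's R2 instance `thetaSubquotientStub q ι` with
  `q := (Π^tp_X ↠ (Π^tp_X)^Θ)|_U` and `ι := (l·Δ_Θ ↪ (Π^tp_X)^Θ)` — the parameters named in `ThetaSubquotientOfTempered.lean`
  ("`Π^tp_X ↠ (Π^tp_X)^Θ`, `l·Δ_Θ ↪ (Π^tp_X)^Θ` in §5") now THE SETTING'S; `ofSetting D l` := the same over `Π^tp_X` itself;
  rfl dictionary `ofSettingSub_eq` / `ofSettingSub_lDelta` / `ofSettingSub_lDeltaMap` (so every landed law of the R2 instance —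
  abc-iut-w5-d020's p418890, p427270/p427537, abc-iut-w4-d042's p429126 — applies verbatim);
* `ThetaSubquotient.killQ_eq_inf_of_le_normalizer` / `kill_eq_comap_of_le_normalizer` — the carrier `Λ/J(S)` of the R2 instance
  at a stabiliser `S` with `q(S)` normalised by `L = ι(Λ)` is `Λ/ι⁻¹(q(S) ∩ L)` = print's "`L·q(S)/q(S)`" (generalising
  `kill_eq_of_normal`, which needs `q(S)` normal in the whole of `Q`);
* **`ThetaSubquotient.lDeltaEquivOfSettingSub`** — at a connected object `E` of `B^temp(U)⁰` with a point `x` whose stabiliser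
  image `q(Stab x)` is normalised by `l·Δ_Θ`: `(l·Δ_Θ)_E ≃* l·Δ_Θ ⧸ (l·Δ_Θ ∩ q(Stab x))`; **`lDeltaQEquivOfSettingSub`** — at
  the Galois objects `U/N` of `B^temp(U)` (abc-iut-L3's `BTemp.Q`), for `U` tempered and `l·Δ_Θ ⊆ q(U)` (the double underline
  situation: `l·Δ_Θ ⊆ (Π^tp_X̲̲)^Θ`), `(l·Δ_Θ)_{U/N} ≃* l·Δ_Θ ⧸ (l·Δ_Θ ∩ q(N))` — print's `L·q(N)/q(N) ⊆ Q/q(N) = Aut^Θ(U/N)`;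
  `lDeltaQEquivOfSetting` — the single underline case over `Π^tp_X` (`q` onto, abc-iut-L2-t9's `lDeltaQEquiv`).
Universe: everything lives in `Type` (universe `0`), as abc-iut-L2-t4's §5 data over the setting require (MERGE-PLAN row 9).

HONEST FRAMING: a construction over abc-iut-L2-t1's DATA structure `ThetaSetting` (whose fields quote [EtTh] §1) — nothing
asserts that such data exist for an actual curve; `U` is a parameter (no claim that a given `U` IS `Π^tp_X̲̲`); [EtTh] is a
refereed paper and nothing here bears on [IUTchIII] Cor. 3.12 — no side is taken; typed ≠ proved.
-/

noncomputable section

namespace Literature.AnabelianGeometry.EtaleTheta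

open CategoryTheory Literature.AlgebraicGeometry.Frobenioids Literature.AnabelianGeometry.SemiGraphs
open Literature.AlgebraicGeometry.Frobenioids.QuasiTemperoid (stabilizerSubgroup)

-- Mathlib's (deliberately scoped) instance `[Group G] [IsMulCommutative G] : CommGroup G` (the device of
-- `EtaleThetaClass.lean` / `ContH1.lean`): `l·Δ_Θ` is a `CommGroup` with the SAME operations as the subgroup.
open scoped IsMulCommutative

/-! ### 1. `l·Δ_Θ` is commutative -/

namespace ThetaSetting

variable {p : ℕ} [Fact p.Prime] (D : ThetaSetting p) (l : ℕ)

/-- `l·Δ_Θ ⊆ Δ_Θ (≅ Ẑ(1))` is commutative (p. 12: field `ker_thetaToEll_comm` of the setting; cf.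
`EtaleThetaClass.deltaTheta_comm` for `Δ_Θ` itself). [cite: MochizukiEtTh2009, §1 p.237 (PDF p.11)] -/
instance lDeltaTheta_isMulCommutative : IsMulCommutative (D.lDeltaTheta l) :=
  ⟨⟨fun a b => Subtype.ext
    (D.ker_thetaToEll_comm a.1 (D.lDeltaTheta_le l a.2) b.1 (D.lDeltaTheta_le l b.2))⟩⟩

/-- The inclusion `ι : l·Δ_Θ ↪ (Π^tp_X)^Θ` has image `l·Δ_Θ`, a normal subgroup (abc-iut-L2-t2's `lDeltaTheta_normal`) — the
standing hypothesis `[ι.range.Normal]` of abc-iut-L2-t9's R2 instance. [cite: MochizukiEtTh2009, §5 p.327 (PDF p.101)] -/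
instance range_subtype_lDeltaTheta_normal : ((D.lDeltaTheta l).subtype.range).Normal := by
  rw [Subgroup.range_subtype]; infer_instance

/-- `ι(l·Δ_Θ) = l·Δ_Θ`. [cite: MochizukiEtTh2009, §5 p.327 (PDF p.101)] -/
theorem range_subtype_lDeltaTheta : (D.lDeltaTheta l).subtype.range = D.lDeltaTheta l :=
  Subgroup.range_subtype _

end ThetaSetting

/-! ### 2. The pin: `Q := (l·Δ_Θ)_(−)` over `B^temp(U)⁰`, `U ⊆ Π^tp_X` -/

namespace ThetaSubquotient

section Pin

variable {p : ℕ} [Fact p.Prime] (D : ThetaSetting p) (l : ℕ) (U : Subgroup D.PiTemp)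

/-- `q := (Π^tp_X ↠ (Π^tp_X)^Θ)|_U : U → (Π^tp_X)^Θ`, the parameter "`q`" of the R2 instance for the base `B^temp(U)⁰`
(p. 327: "these subquotients [of `Π^tp_X`] determine subquotients `Aut_D(D) ↠ Aut^Θ_D(D)`").
[cite: MochizukiEtTh2009, §5 p.327 (PDF p.101)] -/
abbrev qSub : ↥U →* D.GtpTheta := D.toTheta.comp U.subtype

/-- `ι := (l·Δ_Θ ↪ (Π^tp_X)^Θ)`, the parameter "`ι`" of the R2 instance. [cite: MochizukiEtTh2009, §5 p.327 (PDF p.101)] -/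
abbrev ιTheta : ↥(D.lDeltaTheta l) →* D.GtpTheta := (D.lDeltaTheta l).subtype

/-- **The theta subquotients of the §5 data over `D := B^temp(U)⁰`, `U ⊆ Π^tp_X`** — abc-iut-L2-t4's datum field
`toThetaSubquotientStub` PINNED to the §1 setting: abc-iut-L2-t9's R2 instance `thetaSubquotientStub q ι` ("`(l·Δ_Θ)_E` =
compatible families `E → l·Δ_Θ/ι⁻¹J(Stab x)`", `ThetaSubquotientOfTempered.lean`) at `q := (Π^tp_X ↠ (Π^tp_X)^Θ)|_U`,
`ι := l·Δ_Θ ↪ (Π^tp_X)^Θ`.  Double underline case: `U := Π^tp_X̲̲` (`DoubleUnderline.Huu`); single underline case "`A = X`":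
`U := ⊤`, or `ofSetting` below. [cite: MochizukiEtTh2009, §5 p.327 (PDF p.101)] -/
def ofSettingSub : FrobenioidTheta.ThetaSubquotientStub.{0} (ConnectedPart (BTemp ↥U)) :=
  thetaSubquotientStub (qSub D U) (ιTheta D l)

/-- `ofSettingSub` IS the R2 instance at `(q, ι)` (definitionally) — so its laws (`Discharge/Sec5TransportLaws`,
`ThetaSubquotientOfTemperedGalois/Aut/Quotient`, `Discharge/Sec5ThetaSubquotientAutLaws`) apply verbatim.
[cite: MochizukiEtTh2009, §5 p.327 (PDF p.101)] -/
theorem ofSettingSub_eq : ofSettingSub D l U = thetaSubquotientStub (qSub D U) (ιTheta D l) := rfl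

/-- The carrier at `E`: `(l·Δ_Θ)_E = LDelta q ι E`. [cite: MochizukiEtTh2009, §5 p.327 (PDF p.101)] -/
theorem ofSettingSub_lDelta (E : ConnectedPart (BTemp ↥U)) :
    (ofSettingSub D l U).lDelta E = LDelta (qSub D U) (ιTheta D l) E.obj := rfl

/-- The transport along `f : E → E'`: push-forward `map`. [cite: MochizukiEtTh2009, §5 p.327 (PDF p.101)] -/
theorem ofSettingSub_lDeltaMap {E E' : ConnectedPart (BTemp ↥U)} (f : E ⟶ E') :
    (ofSettingSub D l U).lDeltaMap f = map (qSub D U) (ιTheta D l) E.property E'.property f.hom := rfl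

/-- **Single underline case "`A = X`"**: the theta subquotients over `B^temp(Π^tp_X)⁰` itself, `q := Π^tp_X ↠ (Π^tp_X)^Θ`.
[cite: MochizukiEtTh2009, §5 p.322 (PDF p.96)] -/
def ofSetting : FrobenioidTheta.ThetaSubquotientStub.{0} (ConnectedPart (BTemp D.PiTemp)) :=
  thetaSubquotientStub D.toTheta (ιTheta D l)

/-- `ofSetting` IS the R2 instance at `(Π^tp_X ↠ (Π^tp_X)^Θ, l·Δ_Θ ↪ (Π^tp_X)^Θ)` (definitionally).
[cite: MochizukiEtTh2009, §5 p.327 (PDF p.101)] -/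
theorem ofSetting_eq : ofSetting D l = thetaSubquotientStub D.toTheta (ιTheta D l) := rfl

/-- The carrier of `ofSetting` at `E`. [cite: MochizukiEtTh2009, §5 p.327 (PDF p.101)] -/
theorem ofSetting_lDelta (E : ConnectedPart (BTemp D.PiTemp)) :
    (ofSetting D l).lDelta E = LDelta D.toTheta (ιTheta D l) E.obj := rfl

end Pin

/-! ### 3. The carrier at a stabiliser whose image is normalised by `L`: `Λ/J(S) = Λ/ι⁻¹(q(S) ∩ L)` -/

section Normalizer

universe u v w

variable {G : Type u} [Group G] {Q : Type v} [Group Q] {Λ : Type w} [CommGroup Λ] (q : G →* Q) (ι : Λ →* Q)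

/-- If `L = ι(Λ)` is normal and normalises `q(S)`, then `J(S) = (q(S) ∩ L)·[L, q(S)] = q(S) ∩ L` (the commutators
`[l, s]`, `l ∈ L`, `s ∈ q(S)`, lie in `q(S) ∩ L`).  Generalises `killQ_eq_of_normal` (there `q(S)` is normal in `Q`).
[cite: MochizukiEtTh2009, §5 p.327 (PDF p.101)] -/
theorem killQ_eq_inf_of_le_normalizer [ι.range.Normal] {S : Subgroup G} (h : ι.range ≤ Subgroup.normalizer (S.map q : Set Q)) :
    killQ q ι S = S.map q ⊓ ι.range := by
  refine le_antisymm (sup_le le_rfl ?_) le_sup_left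
  rw [Subgroup.commutator_le]
  intro a ha b hb
  refine ⟨?_, ?_⟩
  · -- `a b a⁻¹ ∈ q(S)` since `a` normalises `q(S)`; then `a b a⁻¹ b⁻¹ ∈ q(S)`
    have hab : a * b * a⁻¹ ∈ S.map q := (Subgroup.mem_normalizer_iff.mp (h ha) b).mp hb
    simpa [commutatorElement_def] using mul_mem hab (inv_mem hb)
  · -- `b a⁻¹ b⁻¹ ∈ L` since `L` is normal; then `a (b a⁻¹ b⁻¹) ∈ L`
    have hba : b * a⁻¹ * b⁻¹ ∈ ι.range := Subgroup.Normal.conj_mem inferInstance _ (inv_mem ha) b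
    have : a * (b * a⁻¹ * b⁻¹) ∈ ι.range := mul_mem ha hba
    simpa [commutatorElement_def, mul_assoc] using this

/-- Hence the subgroup killed in `Λ` is `ι⁻¹(q(S) ∩ L)`: the carrier `Λ/J(S)` is print's `L·q(S)/q(S) ≅ L/(L ∩ q(S))`.
[cite: MochizukiEtTh2009, §5 p.327 (PDF p.101)] -/
theorem kill_eq_comap_of_le_normalizer [ι.range.Normal] {S : Subgroup G} (h : ι.range ≤ Subgroup.normalizer (S.map q : Set Q)) :
    kill q ι S = (S.map q ⊓ ι.range).comap ι := by
  rw [kill, killQ_eq_inf_of_le_normalizer q ι h]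

/-- `L` normalises `q(N)` as soon as `L ⊆ q(G)` and `N` is normal in `G` (the double underline situation:
`l·Δ_Θ ⊆ (Π^tp_X̲̲)^Θ = q(Π^tp_X̲̲)`). [cite: MochizukiEtTh2009, §5 p.327 (PDF p.101)] -/
theorem range_le_normalizer_map_of_le_range {N : Subgroup G} [N.Normal] (hL : ι.range ≤ q.range) :
    ι.range ≤ Subgroup.normalizer (N.map q : Set Q) := by
  intro a ha
  obtain ⟨g, rfl⟩ := hL ha
  rw [Subgroup.mem_normalizer_iff]
  intro b
  constructor
  · rintro ⟨n, hn, rfl⟩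
    exact ⟨g * n * g⁻¹, Subgroup.Normal.conj_mem inferInstance n hn g, by simp [map_mul, map_inv]⟩
  · rintro ⟨n, hn, hb⟩
    refine ⟨g⁻¹ * n * g, ?_, ?_⟩
    · simpa using Subgroup.Normal.conj_mem inferInstance n hn g⁻¹
    · have : b = (q g)⁻¹ * q n * q g := by
        rw [hb]; group
      rw [this]; simp [map_mul, map_inv]

end Normalizer

/-! ### 4. Explicit carriers of the pinned subquotients at connected and Galois objects -/

section Explicit

variable {p : ℕ} [Fact p.Prime] (D : ThetaSetting p) (l : ℕ) (U : Subgroup D.PiTemp)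

/-- **`(l·Δ_Θ)_E ≃* l·Δ_Θ ⧸ (l·Δ_Θ ∩ q(Stab x))`** for a connected object `E` of `B^temp(U)⁰` and a point `x ∈ E` whose
stabiliser image `q(Stab x) ⊆ (Π^tp_X)^Θ` is normalised by `l·Δ_Θ` (e.g. `Stab x` normal in `U` and `l·Δ_Θ ⊆ q(U)`): evaluation at
`x` (abc-iut-L2-t9's `evalEquiv`) followed by `kill_eq_comap_of_le_normalizer`.  Print: `(l·Δ_Θ)_E = L·q(Stab x)/q(Stab x)`.
[cite: MochizukiEtTh2009, §5 p.327 (PDF p.101)] -/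
def lDeltaEquivOfSettingSub (E : ConnectedPart (BTemp ↥U)) (x : E.obj.obj.V)
    (hx : (ιTheta D l).range ≤ Subgroup.normalizer ((stabilizerSubgroup E.obj x).map (qSub D U) : Set D.GtpTheta)) :
    (ofSettingSub D l U).lDelta E ≃*
      ↥(D.lDeltaTheta l) ⧸ ((stabilizerSubgroup E.obj x).map (qSub D U) ⊓ (ιTheta D l).range).comap (ιTheta D l) :=
  (evalEquiv (qSub D U) (ιTheta D l) E.property x).trans
    (QuotientGroup.quotientMulEquivOfEq (kill_eq_comap_of_le_normalizer (qSub D U) (ιTheta D l) hx))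

variable [hUtop : IsTopologicalGroup ↥U]

/-- **At the Galois objects `U/N` of `B^temp(U)` (`U` tempered, `N` open normal; abc-iut-L3's `BTemp.Q`), when
`l·Δ_Θ ⊆ q(U)`** (the double underline situation "`l·Δ_Θ ⊆ (Π^tp_X̲̲)^Θ`"): `(l·Δ_Θ)_{U/N} ≃* l·Δ_Θ ⧸ (l·Δ_Θ ∩ q(N))` — print's
`L·q(N)/q(N)`, the image of `l·Δ_Θ` in `Aut^Θ_D(U/N) = q(U)/q(N)` ON THE NOSE (stabilisers of `U/N` are all `N`:
`stabilizerSubgroup_Q`). [cite: MochizukiEtTh2009, §5 p.327 (PDF p.101)] -/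
def lDeltaQEquivOfSettingSub (hU : IsTempered ↥U) (hL : (ιTheta D l).range ≤ (qSub D U).range)
    (N : OpenNormalSubgroup ↥U) :
    (ofSettingSub D l U).lDelta ⟨BTemp.Q hU N, isConnectedObj_Q hU N⟩ ≃*
      ↥(D.lDeltaTheta l) ⧸ (N.toSubgroup.map (qSub D U) ⊓ (ιTheta D l).range).comap (ιTheta D l) :=
  (evalEquiv (qSub D U) (ιTheta D l) (isConnectedObj_Q hU N) ((1 : ↥U) : ↥U ⧸ N.toSubgroup)).trans
    (QuotientGroup.quotientMulEquivOfEq (by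
      rw [kill_eq_comap_of_le_normalizer (qSub D U) (ιTheta D l)
        (by rw [stabilizerSubgroup_Q]; exact range_le_normalizer_map_of_le_range _ _ hL), stabilizerSubgroup_Q]))

/-- The class of a compatible family `t` under `lDeltaQEquivOfSettingSub`: the class of its value at the coset of `1`.
[cite: MochizukiEtTh2009, §5 p.327 (PDF p.101)] -/
theorem lDeltaQEquivOfSettingSub_mk (hU : IsTempered ↥U) (hL : (ιTheta D l).range ≤ (qSub D U).range)
    (N : OpenNormalSubgroup ↥U) (t : Fam (qSub D U) (ιTheta D l) (BTemp.Q hU N)) :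
    lDeltaQEquivOfSettingSub D l U hU hL N (mk (qSub D U) (ιTheta D l) _ t) =
      QuotientGroup.mk ((t : (BTemp.Q hU N).obj.V → ↥(D.lDeltaTheta l)) ((1 : ↥U) : ↥U ⧸ N.toSubgroup)) :=
  rfl

omit hUtop in
/-- **Single underline case over `Π^tp_X`** (`q = Π^tp_X ↠ (Π^tp_X)^Θ` is ONTO, field `toTheta_surjective`): at the Galois
objects `Π^tp_X/N`, `(l·Δ_Θ)_{Π^tp_X/N} ≃* l·Δ_Θ ⧸ (l·Δ_Θ ∩ q(N))` — abc-iut-L2-t9's `lDeltaQEquiv` at the setting.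
[cite: MochizukiEtTh2009, §5 p.327 (PDF p.101)] -/
def lDeltaQEquivOfSetting (hT : IsTempered D.PiTemp) (N : OpenNormalSubgroup D.PiTemp) :
    (ofSetting D l).lDelta ⟨BTemp.Q hT N, isConnectedObj_Q hT N⟩ ≃*
      ↥(D.lDeltaTheta l) ⧸ (N.toSubgroup.map D.toTheta ⊓ (ιTheta D l).range).comap (ιTheta D l) :=
  lDeltaQEquiv hT D.toTheta (ιTheta D l) D.toTheta_surjective N

omit hUtop in
/-- In both formulas the killed subgroup is literally "`l·Δ_Θ ∩ q(N)`" inside `l·Δ_Θ`: membership unfolds to `(a : (Π^tp_X)^Θ)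
∈ q(N)`. [cite: MochizukiEtTh2009, §5 p.327 (PDF p.101)] -/
theorem mem_comap_inf_range_iff (N : Subgroup ↥U) (a : ↥(D.lDeltaTheta l)) :
    a ∈ (N.map (qSub D U) ⊓ (ιTheta D l).range).comap (ιTheta D l) ↔ (a : D.GtpTheta) ∈ N.map (qSub D U) := by
  simp only [Subgroup.mem_comap, Subgroup.mem_inf, Subgroup.coe_subtype]
  exact ⟨fun h => h.1, fun h => ⟨h, ⟨a, rfl⟩⟩⟩

end Explicit

end ThetaSubquotient

end Literature.AnabelianGeometry.EtaleTheta

end
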